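import Summits.CriticalPhenomena.Ising3DConformalLimit.Theses.FKParityRobustness
import Summits.CriticalPhenomena.Ising3DConformalLimit.Theorems.FKParityRobustnessSourceTrailsMeetSquareIff
import Summits.CriticalPhenomena.Ising3DConformalLimit.Theorems.FKParityRobustnessParityBound
import Summits.CriticalPhenomena.Ising3DConformalLimit.Theorems.FKParityRobustnessShadowGivesJoin
import Summits.CriticalPhenomena.Ising3DConformalLimit.Theorems.FKParityRobustnessIndependentStrandsJoinStubTransfer
import Summits.CriticalPhenomena.Ising3DConformalLimit.Theorems.FKParityRobustnessIndependentStrandsJoinStubSeparation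
import Summits.CriticalPhenomena.Ising3DConformalLimit.Theorems.FKParityRobustnessIndependentStrandsJoinStubSymmetry
import Summits.CriticalPhenomena.Ising3DConformalLimit.Theorems.FKParityRobustnessIndependentStrandsJoinStubBoxSymmetry
import Summits.CriticalPhenomena.Ising3DConformalLimit.Theorems.FKParityRobustnessIndependentStrandsJoinStubPairSplit
import Summits.CriticalPhenomena.Ising3DConformalLimit.Theorems.FKParityRobustnessIndependentStrandsJoinStubDepletionBound
import Summits.CriticalPhenomena.Ising3DConformalLimit.Theorems.FKParityRobustnessJoinForcesU4
import Summits.CriticalPhenomena.Ising3DConformalLimit.Theorems.FKParityRobustnessAssembly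
import HarnessLib

/-!
# `SourceTrailsMeet` (stmt-CriticalPhenomena-11255) sits ABOVE the route's spine:
# `SourceTrailsMeet → IndependentStrandsJoin`, hence `→ NonGaussianLimit` and
# `SourceTrailsMeet → MoebiusLimit → Ising3DConformalLimit`

Route `FKParityRobustness`, sub-problem `Ising3DConformalLimit`.  The support item `SourceTrailsMeet`
(two critical sourced high-temperature trails of ONE loop-O(1) configuration in the free box `Λ_N ⊂ ℤ³`
meet with `ℓ`-weight `≥ c · Z(a₀a₁) Z(a₂a₃) / Z(∅)`, uniformly in the scale `l` of the tetrahedron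
`a = l · tetra`) was known to be the merged FK rung `ParityRobustMerging ∧ FKFourConnectivity` read on
the loop side (`sourceTrailsMeet_iff_parityRobustMerging_and_fkFourConnectivity`).  This file adds the
third arrow of the square and closes the logical picture of the item inside the route:

* `tetraU4Lattice_of_sourceTrailsMeet` : the item gives lattice `U₄`-hyperscaling at regular tetrahedra
  in SPIN dress, `U₄^{free}_{Λ_N}(l·tetra) ≤ −2c ⟨σ_{a₀}σ_{a₁}⟩_{Λ_N} ⟨σ_{a₂}σ_{a₃}⟩_{Λ_N}` at `β_c(3)`,
  same `N₀(l)` — the statement `TetraU4Lattice` of the crux line `Cruxes/IndependentStrandsJoin/Lines/Sketch.lean`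
  (from `connectedFour_le_of_sourceTrailsMeet_of_parityBound`, the PROVED route item `ParityBound`
  (`parityBound_proof`) and the Edwards–Sokal / high-temperature dictionary
  `φ_N[x ↔ y] = Z({x,y})/Z(∅) = ⟨σ_xσ_y⟩^{free}_{Λ_N}`);
* `independentStrandsJoin_of_sourceTrailsMeet` : **`SourceTrailsMeet → IndependentStrandsJoin`**, the
  route's rank-2 CRUX (item 14625), with constant `2c/3`: the tetrahedral sandwich of that crux's line
  `Sketch`, all of whose non-crux stubs are landed (`stub_separation`, `stub_depletionBound`,
  `stub_pairSplit`, `stub_symmetry`, `stub_boxSymmetry`, and the algebraic core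
  `StubTransfer.joint_ge_of_sep_sym_u4` of `stub_transfer`), turns `TetraU4Lattice` into the crux.
  (The landed stub files elaborate the shared sums with different `Decidable` instances, so they are
  glued with `convert`, not by literal application; in particular `stub_transfer … : <crux body>` does
  not unify with the route decl within the default heartbeat budget — noted for the crux lead.)
  In words: if the two source trails of ONE critical configuration meet with probability
  bounded below, then so do the source clusters of two INDEPENDENT configurations (same-configuration
  meeting is the harder event: Lebowitz `U₄ ≤ 0` + the separation bound
  `Z^{01}Z^{23} − meetSum ≤ sepSum · Z⁰` + pairing symmetry give `Z(A; joined) · Z⁰ ≤ 3 · meetSum`);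
* `not_sourceTrailsMeet_of_not_independentStrandsJoin` : the third kill switch (with
  `not_sourceTrailsMeet_of_not_parityRobustMerging`, `not_sourceTrailsMeet_of_not_fkFourConnectivity`);
* `sourceTrailsMeet_dominates` : `SourceTrailsMeet → IndependentStrandsJoin ∧ ParityRobustMerging ∧
  FKFourConnectivity` — the item implies EVERY open lattice item of the route;
* `nonGaussianLimit_of_sourceTrailsMeet` : with the proved bridge `JoinForcesU4` (`joinForcesU4_proof`),
  the item alone gives the route's payload, clause (iii) of the conjunct (every non-degenerate pointwise
  scaling limit of critical 3D Ising has `U₄ ≢ 0`);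
* `ising3DConformalLimit_of_sourceTrailsMeet_of_moebiusLimit` : `SourceTrailsMeet → MoebiusLimit →
  Ising3DConformalLimit` (through the landed assembly `fkParityRobustness_assembly_proof`): the item is a
  one-item alternative spine of the route, conditional only on the imported complement `MoebiusLimit`.

Consequences for the item's status (recorded, not claimed as progress on the open problem): an
unconditional proof of `SourceTrailsMeet` would prove non-triviality of the critical 3D Ising scaling
limit; a refutation of any of `IndependentStrandsJoin`, `ParityRobustMerging`, `FKFourConnectivity` refutes
it in one line.  Theorem-only file; no new definitions; no named facts are assumed.

References: M. Aizenman, Comm. Math. Phys. 86 (1982), Prop. 5.3 and Lemma 9.3 [AizenmanCMP1982];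
M. Aizenman, H. Duminil-Copin, Ann. of Math. 194 (2021), eq. (3.11) [AizenmanDuminilCopinAnnals2021];
G. Grimmett, S. Janson, Electron. J. Combin. 16 (2009), Thm 3.1 [GrimmettJanson2007];
U. T. Hansen, J. Jiang, F. R. Klausen, arXiv:2506.10765, §2 [HansenJiangKlausen2025].
-/

noncomputable section

open MeasureTheory Finset SimpleGraph
open Literature.Probability.LatticeModels
open Literature.Probability.Percolation
open Summit.CriticalPhenomena.Ising3DConformalLimit.Theses.FKParityRobustness
open Summit.CriticalPhenomena.Ising3DConformalLimit.FKParityRobustnessJoinForcesU4 (joinForcesU4_proof)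

namespace Summit.CriticalPhenomena.Ising3DConformalLimit.Theorems

open scoped Classical

/-- **`SourceTrailsMeet` gives lattice `U₄`-hyperscaling at regular tetrahedra (spin dress).**
If `SourceTrailsMeet` holds with constant `c`, then for all `l ≥ 1`, all `N ≥ N₀(l)` and
`a = l · tetra ⊂ Λ_N`, the free critical Ising measure of the `Λ_N`-induced graph satisfies
`U₄(a) ≤ −(2c) · ⟨σ_{a₀}σ_{a₁}⟩ · ⟨σ_{a₂}σ_{a₃}⟩`.  This is the statement `TetraU4Lattice` of the crux
line `Cruxes/IndependentStrandsJoin/Lines/Sketch.lean`, obtained from the FK-dress bound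
`connectedFour_le_of_sourceTrailsMeet_of_parityBound` (with the proved route item `ParityBound`) by the
dictionary `φ_N[x ↔ y] = Z({x,y})/Z(∅)` (`rcMeasure_real_openConn_eq`, Grimmett–Janson) and
`⟨σ_xσ_y⟩^{free} = Z({x,y})/Z(∅)` (`isingCorr_univ_free_eq_loopO1_div`, high-temperature expansion).
[cite: AizenmanDuminilCopinAnnals2021, eq. (3.11)] -/
theorem tetraU4Lattice_of_sourceTrailsMeet :
    SourceTrailsMeet →
    ∃ c : ℝ, 0 < c ∧ ∀ l : ℕ, 1 ≤ l → ∃ N₀ : ℕ, ∀ N : ℕ, N₀ ≤ N → ∀ a : Fin 4 → ↥(box 3 N),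
      (∀ i, ((a i : Site 3)) = (l : ℤ) •
        (![![-1, -1, -1], ![1, 1, -1], ![1, -1, 1], ![-1, 1, 1]] : Fin 4 → Site 3) i) →
      connectedFour (isingMeasure ((zdGraph 3).comap (Subtype.val : ↥(box 3 N) → Site 3))
          Finset.univ (criticalBeta 3) 0 .free) spinAt a
        ≤ -(c * isingCorr ((zdGraph 3).comap (Subtype.val : ↥(box 3 N) → Site 3)) Finset.univ
              (criticalBeta 3) 0 .free {a 0, a 1} *
            isingCorr ((zdGraph 3).comap (Subtype.val : ↥(box 3 N) → Site 3)) Finset.univ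
              (criticalBeta 3) 0 .free {a 2, a 3}) := by
  intro hS
  obtain ⟨c, hc, h⟩ := connectedFour_le_of_sourceTrailsMeet_of_parityBound hS parityBound_proof
  refine ⟨2 * c, by positivity, fun l hl => ?_⟩
  obtain ⟨N₀, h⟩ := h l hl
  refine ⟨N₀, fun N hN a ha => ?_⟩
  have key := h N hN a ha
  dsimp only at key
  have hβ : 0 ≤ criticalBeta 3 := criticalBeta_nonneg 3
  have hainj : Function.Injective a :=
    Summit.CriticalPhenomena.Ising3DConformalLimit.Cruxes.ParityRobustMerging.PlaquetteXorSurgery.tetra_injective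
      hl a ha
  have hES : ∀ x y : ↥(box 3 N), x ≠ y →
      (rcMeasure ((zdGraph 3).comap (Subtype.val : ↥(box 3 N) → Site 3))
          (fkIsingParam (criticalBeta 3)) 2 ∅).real (openConn x y) =
        isingCorr ((zdGraph 3).comap (Subtype.val : ↥(box 3 N) → Site 3)) Finset.univ
          (criticalBeta 3) 0 .free {x, y} := by
    intro x y hxy
    rw [rcMeasure_real_openConn_eq _ hβ hxy, isingCorr_univ_free_eq_loopO1_div,
      loopO1PartitionFunction_eq_sum_tJoins _ _ {x, y}]
  rw [hES (a 0) (a 1) (hainj.ne (by decide)), hES (a 2) (a 3) (hainj.ne (by decide))] at key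
  linarith [key]

/-- **`SourceTrailsMeet → IndependentStrandsJoin`** (the route's rank-2 crux, item 14625; constant
`2c/3`, same `N₀(l)`).  Composition of `tetraU4Lattice_of_sourceTrailsMeet` with the fully landed
tetrahedral sandwich of the crux line `Sketch`, box by box: the separation bound
`Z^{01}Z^{23} − meetSum ≤ sepSum · Z⁰` (`stub_separation stub_depletionBound stub_pairSplit`: the
depletion lever, AF86 Claim (4.15) on source clusters, and the pair-split identity), the pairing
symmetry `3 · sepSum ≤ Z^{0123}`, `Z^{02}Z^{13} = Z^{01}Z^{23} = Z^{03}Z^{12}` (`stub_symmetry` on the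
automorphisms of `stub_boxSymmetry`), and the algebraic core `StubTransfer.joint_ge_of_sep_sym_u4`.
The three landed files elaborate the shared finite sums with different `Decidable` instances (classical
vs. `Mathlib`'s constructive ones), so the pieces are matched with `convert` (instance arguments are
subsingletons) rather than applied literally — which is also why `stub_transfer` is not applied as is.
Informally: meeting of the two source trails of ONE critical loop-O(1) configuration with probability
bounded below forces meeting of the source clusters of two INDEPENDENT configurations, because
`Z(A; joined) · Z⁰ = U₄ (Z⁰)² + 3 (Z^{01}Z^{23} − sepSum · Z⁰) ≤ 3 · meetSum ≤ 3 · jointSum`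
(Lebowitz `U₄ ≤ 0`).  [cite: AizenmanCMP1982, Prop. 5.3 and Lemma 9.3] -/
theorem independentStrandsJoin_of_sourceTrailsMeet : SourceTrailsMeet → IndependentStrandsJoin := by
  intro hS
  obtain ⟨c, hc, hU⟩ := tetraU4Lattice_of_sourceTrailsMeet hS
  unfold IndependentStrandsJoin
  dsimp only
  refine ⟨c / 3, by positivity, fun l hl => ?_⟩
  obtain ⟨N₀, hN⟩ := hU l hl
  refine ⟨N₀, fun N hN' a ha => ?_⟩
  have hβ : 0 ≤ criticalBeta 3 := criticalBeta_nonneg 3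
  have ha' : Function.Injective a :=
    Summit.CriticalPhenomena.Ising3DConformalLimit.Cruxes.ParityRobustMerging.PlaquetteXorSurgery.tetra_injective
      hl a ha
  obtain ⟨hφ, hψ⟩ := stub_boxSymmetry l N a ha
  have hSym := stub_symmetry ↥(box 3 N) ((zdGraph 3).comap (Subtype.val : ↥(box 3 N) → Site 3))
    (Real.tanh (criticalBeta 3))
    Summit.CriticalPhenomena.Ising3DConformalLimit.Cruxes.ParityRobustMerging.PlaquetteXorSurgery.tanh_criticalBeta_nonneg
    a ha' hφ hψ
  have hSep := stub_separation stub_depletionBound stub_pairSplit ↥(box 3 N)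
    ((zdGraph 3).comap (Subtype.val : ↥(box 3 N) → Site 3)) (criticalBeta 3) hβ a ha'
  have hUN := hN N hN' a ha
  have key := StubTransfer.joint_ge_of_sep_sym_u4
    ((zdGraph 3).comap (Subtype.val : ↥(box 3 N) → Site 3)) hβ a ha'
    (by convert hSep) (by convert hSym) (by convert hUN)
  convert key

/-- **Third kill switch for the item**: a refutation of the crux `IndependentStrandsJoin` refutes
`SourceTrailsMeet` (contrapositive of `independentStrandsJoin_of_sourceTrailsMeet`; companions:
`not_sourceTrailsMeet_of_not_parityRobustMerging`, `not_sourceTrailsMeet_of_not_fkFourConnectivity`).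
[folklore] -/
theorem not_sourceTrailsMeet_of_not_independentStrandsJoin :
    ¬ IndependentStrandsJoin → ¬ SourceTrailsMeet :=
  mt independentStrandsJoin_of_sourceTrailsMeet

/-- **The item dominates the route's lattice items**: `SourceTrailsMeet` implies the crux
`IndependentStrandsJoin` (this file) and both FK rungs `ParityRobustMerging`, `FKFourConnectivity`
(`sourceTrailsMeet_iff_parityRobustMerging_and_fkFourConnectivity`). [folklore] -/
theorem sourceTrailsMeet_dominates :
    SourceTrailsMeet → IndependentStrandsJoin ∧ ParityRobustMerging ∧ FKFourConnectivity :=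
  fun hS => ⟨independentStrandsJoin_of_sourceTrailsMeet hS,
    sourceTrailsMeet_iff_parityRobustMerging_and_fkFourConnectivity.mp hS⟩

/-- **The item alone gives the route's payload, clause (iii)**: `SourceTrailsMeet → NonGaussianLimit`
(every non-degenerate pointwise scaling limit of the critical Ising correlators on `ℤ³` has `U₄ ≢ 0`),
through the crux `IndependentStrandsJoin` and the PROVED bridge `JoinForcesU4` (`joinForcesU4_proof`:
Aizenman's identity, the odd-part law, the box limit at `β_c` and far merging along dilations).
In particular an unconditional proof of the item would settle non-triviality of critical 3D Ising.
[cite: AizenmanCMP1982, Prop. 5.3] -/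
theorem nonGaussianLimit_of_sourceTrailsMeet : SourceTrailsMeet → NonGaussianLimit :=
  fun hS => joinForcesU4_proof (independentStrandsJoin_of_sourceTrailsMeet hS)

/-- **One-item alternative spine**: `SourceTrailsMeet → MoebiusLimit → Ising3DConformalLimit`, by the
landed assembly `fkParityRobustness_assembly_proof` (`IndependentStrandsJoin → JoinForcesU4 →
MoebiusLimit → Ising3DConformalLimit`) fed with `independentStrandsJoin_of_sourceTrailsMeet` and
`joinForcesU4_proof`; conditional only on the imported complement `MoebiusLimit` (item 1344).
[folklore] -/
theorem ising3DConformalLimit_of_sourceTrailsMeet_of_moebiusLimit :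
    SourceTrailsMeet → MoebiusLimit → _root_.Ising3DConformalLimit :=
  fun hS => fkParityRobustness_assembly_proof (independentStrandsJoin_of_sourceTrailsMeet hS)
    joinForcesU4_proof

end Summit.CriticalPhenomena.Ising3DConformalLimit.Theorems

end
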